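import Summits.BirchSwinnertonDyer.BirchSwinnertonDyer.Theorems.GenusKolyvaginAtTwoGenusDeepSupplyAtTwoNegDiscNarrowDepthZeroTwistedLocalReading
import Summits.BirchSwinnertonDyer.BirchSwinnertonDyer.Theorems.GenusKolyvaginAtTwoGenusDeepSupplyAtTwoNegDiscNarrowDepthZeroRationalTorsion
import Literature.NumberTheory.EllipticCurves.TateModuleGaloisTransportProofs
import Literature.NumberTheory.QuadraticFields.HeegnerCondition
import Literature.NumberTheory.EllipticCurves.HeegnerPointsImaginaryQuadraticProofs
import Literature.NumberTheory.NumberFields.QuadraticExtensionPlacesProofs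
import HarnessLib

/-!
# Route `GenusKolyvaginAtTwo`, crux `GenusDeepSupplyAtTwoNegDiscNarrow` (stmt-BirchSwinnertonDyer-23491): CLAIM B ON THE CURVE —
# an ANTI-INVARIANT point of `E(K)` with no `Γ_K`-rational half does not reduce to `Õ` at the ramified prime, on the `#Sel₂(E) = 1` cell

Width seat `bsd-line-gk2-p4` g25 (cell `bsd-f1-sign2`), `--supports stmt-BirchSwinnertonDyer-23491` (helper; closes nothing).
THEOREMS ONLY (no definition, no named fact, no `sorry`); **BSD is NOT proved by any of this; no item is closed.**

CONTEXT. Fourth file of Claim B of the LEAD's depth-zero reduction criterion (`DEPTH-ZERO-REDUCTION-CRITERION-g21.md` §2): after the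
global half (p763963), the local Kummer reading (p764224) and the twisted local reading (`…DepthZeroTwistedLocalReading`: for a signed
twist isomorphism `F` and `z ∈ Wd(ℚ)` with `κ(z) ≠ 0`, `red_𝔓(F z̃) ≠ Õ` on the cell), this file moves to the CURVE: the twin point is
replaced by an anti-invariant point `Y ∈ E(K)` (`τY = −Y`; in the cell `Y = y_K − s`, Gross Prop. 5.3), read in `E(ℚ̄)` through the
tree's embedding `e = absEmbedding ℚ K`.

* §1 THE SIGN DICTIONARY for a quadratic field `K`: `σ • √d_K = √d_K ⟺ σ|_K = 1` (`smul_geomSqrt_discr_eq_of_absGaloisQuot_eq_one`,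
  `smul_geomSqrt_discr_eq_neg_of_absGaloisQuot_ne_one`; `√d_K = ±e(δ)` for `δ ∈ 𝓞_K` with `δ² = d_K`, Marcus Thm. 2.1; for `d_K < 0`
  no `ℚ`-rational `δ`), hence the signed untwisting `F : E^{(d_K)}(ℚ̄) ≃+ E(ℚ̄)` of *AEC* X.5 Cor. 5.4 commutes with `σ` iff `σ|_K = 1`
  and anticommutes otherwise (`exists_twistIso_sign_absGaloisQuot`).
* §2 `smul_map_absEmbedding_of_anti` — for `Y ∈ E(K)` with `τY = −Y`: `σ • e_*Y = e_*Y` if `σ|_K = 1`, `= −e_*Y` otherwise; so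
  `F⁻¹(e_*Y)` is `Γ_ℚ`-fixed, i.e. **`e_*Y = F z̃` for a rational point `z` of the twin** (`exists_twin_point_of_anti`, Galois descent
  over `ℚ`), and `κ(z) ≠ 0` as soon as `e_*Y` has no half fixed by `res(Γ_K)` (`kummer_ne_zero_of_no_rational_half`).
* §3 **`geomReduction_map_absEmbedding_ne_zero_of_anti_of_selmerTrivial_prime`** — `W/ℚ` globally minimal, `Δ_W < 0`, `K` imaginary
  quadratic with `d_K = −ℓ` (`ℓ` odd prime), Heegner, `#Sel₂(W) = 1`; `Y ∈ E(K)` anti-invariant whose image `e_*Y ∈ E(ℚ̄)` has NO half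
  fixed by every `σ` with `σ|_K = 1` (⟸ `Y ∉ 2E(K)`; the `K`-rational form needs the relative descent `E(ℚ̄)^{Γ_K} = e_*E(K)`, left to
  the consumer): THEN **`red_𝔓(e_* Y) ≠ Õ`** at the place over `ℓ`. With `Y = P₀ − s₀` (`P₀ ↦ y_K`, `s₀` the Gross 5.3 torsion half)
  this is the LEAD's Claim B «`M₀ = 0 ⟹ red_{λ₀}(y′) ≠ Õ`» in the currency of `DepthZero.nonCMAtTwo_of_items_of_reductionBits` (R₁).

References: [SilvermanAEC2009] X.5 Cor. 5.4, X.2 Prop. 2.4, VIII §1–§2; [GrossLMS1991] §5 Prop. 5.3; [MazurRubin2010] Prop. 3.3;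
[Marcus1977] Ch. 2 Thm. 1; [NeukirchANT1999] IV §1.
-/

set_option linter.dupNamespace false -- tree convention: `Summit.BirchSwinnertonDyer.BirchSwinnertonDyer.Theorems` (summit = sub-problem)
set_option autoImplicit false

noncomputable section

open scoped Classical Pointwise

namespace Summit.BirchSwinnertonDyer.BirchSwinnertonDyer.Theorems.GenusSupplyNarrow.DepthZero

open WeierstrassCurve Field NumberField IsDedekindDomain Function
open Literature.NumberTheory.EllipticCurves Literature.NumberTheory.GaloisRepresentations
open Literature.NumberTheory.GaloisCohomology
open Rat.HeightOneSpectrum (primesEquiv natGenerator)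
open Summit.BirchSwinnertonDyer.BirchSwinnertonDyer.Theorems.GenusKolyArch (hdiv_two)

/-! ## §1 The sign dictionary for a quadratic field -/

section Sign

variable {K : Type} [Field K] [NumberField K]

/-- **`√d_K = ±e(δ)` for some `δ ∈ K` with `δ² = d_K`** (`δ = ω − ω'` for an integral basis, Marcus Ch. 2 Thm. 1; `e = absEmbedding ℚ K`).
[cite: Marcus1977, Ch. 2 Thm. 1] -/
theorem exists_sq_eq_discr_absEmbedding (h2 : Module.finrank ℚ K = 2) :
    ∃ δ : K, δ ^ 2 = algebraMap ℚ K (discr K : ℚ) ∧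
      (absEmbedding ℚ K δ = WeierstrassCurve.geomSqrt (discr K : ℚ) ∨
        absEmbedding ℚ K δ = -WeierstrassCurve.geomSqrt (discr K : ℚ)) := by
  obtain ⟨-, -, δ, -, hδ⟩ := Literature.NumberTheory.QuadraticFields.Quadratic.exists_sq_eq_discr (K := K) h2
  have hδK : ((δ : K)) ^ 2 = algebraMap ℚ K (discr K : ℚ) := by
    have h := congrArg (algebraMap (𝓞 K) K) hδ
    rw [map_pow, map_intCast] at h
    rw [h, map_intCast]
  refine ⟨δ, hδK, ?_⟩
  apply sq_eq_sq_iff_eq_or_eq_neg.mp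
  rw [WeierstrassCurve.geomSqrt_sq, ← map_pow, hδK, AlgHom.commutes]

/-- **`σ|_K = 1 ⟹ σ • √d_K = √d_K`.** [cite: NeukirchANT1999, Ch. IV §1] -/
theorem smul_geomSqrt_discr_eq_of_absGaloisQuot_eq_one (h2 : Module.finrank ℚ K = 2)
    {σ : absoluteGaloisGroup ℚ} (hσ : haveI : Algebra.IsQuadraticExtension ℚ K := ⟨h2⟩; absGaloisQuot ℚ K σ = 1) :
    σ • WeierstrassCurve.geomSqrt (discr K : ℚ) = WeierstrassCurve.geomSqrt (discr K : ℚ) := by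
  haveI : Algebra.IsQuadraticExtension ℚ K := ⟨h2⟩
  obtain ⟨δ, -, hδ⟩ := exists_sq_eq_discr_absEmbedding h2
  have hfix : σ • absEmbedding ℚ K δ = absEmbedding ℚ K δ := by
    rw [← absEmbedding_absGaloisQuot_apply, hσ, AlgEquiv.one_apply]
  rcases hδ with h | h
  · rwa [h] at hfix
  · rw [h, smul_neg] at hfix
    exact neg_injective hfix

/-- **`σ|_K ≠ 1 ⟹ σ • √d_K = −√d_K`** for an IMAGINARY quadratic `K`: `σ|_K` is the non-trivial automorphism, which sends `δ` to `−δ`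
(else `δ` is `ℚ`-rational and `d_K = δ² ≥ 0`). [cite: NeukirchANT1999, Ch. IV §1] [cite: Marcus1977, Ch. 2 Thm. 1] -/
theorem smul_geomSqrt_discr_eq_neg_of_absGaloisQuot_ne_one (hK : IsImaginaryQuadratic K)
    {σ : absoluteGaloisGroup ℚ} (hσ : haveI : Algebra.IsQuadraticExtension ℚ K := ⟨hK.1⟩; absGaloisQuot ℚ K σ ≠ 1) :
    σ • WeierstrassCurve.geomSqrt (discr K : ℚ) = -WeierstrassCurve.geomSqrt (discr K : ℚ) := by
  haveI : Algebra.IsQuadraticExtension ℚ K := ⟨hK.1⟩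
  haveI : IsGalois ℚ K := inferInstance
  obtain ⟨δ, hδ2, hδ⟩ := exists_sq_eq_discr_absEmbedding hK.1
  set τ' := absGaloisQuot ℚ K σ with hτ'
  -- `τ' δ = ±δ`, and `τ' δ = δ` would make `δ` rational
  have hsq : (τ' δ) ^ 2 = δ ^ 2 := by rw [← map_pow, hδ2, AlgEquiv.commutes]
  have hτδ : τ' δ = -δ := by
    rcases sq_eq_sq_iff_eq_or_eq_neg.mp hsq with h | h
    · exfalso
      -- every automorphism fixes `δ`, so `δ ∈ ℚ`
      have hall : ∀ f : K ≃ₐ[ℚ] K, f δ = δ := fun f ↦ by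
        rcases Literature.NumberTheory.NumberFields.algEquiv_eq_one_or_eq_of_finrank_eq_two hK.1 hσ f with rfl | rfl
        · rfl
        · exact h
      obtain ⟨q, hq⟩ := (IsGalois.mem_range_algebraMap_iff_fixed δ).mpr hall
      have hdq : (discr K : ℚ) = q ^ 2 := by
        apply (algebraMap ℚ K).injective
        rw [map_pow, hq, hδ2]
      have hneg : (discr K : ℚ) < 0 := by exact_mod_cast IsImaginaryQuadratic.discr_neg hK
      linarith [sq_nonneg q]
    · exact h
  have hmove : σ • absEmbedding ℚ K δ = -absEmbedding ℚ K δ := by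
    rw [← absEmbedding_absGaloisQuot_apply, ← hτ', hτδ, map_neg]
  rcases hδ with h | h
  · rwa [h] at hmove
  · rw [h, smul_neg, neg_neg] at hmove
    rw [← neg_eq_iff_eq_neg.mpr hmove.symm]

/-- **A signed untwisting whose sign is read on `K`**: for `W/ℚ` and a quadratic `K` with `d = d_K` (imaginary), there is
`F : W^{(d)}(ℚ̄) ≃+ W(ℚ̄)` with `F(σP) = σF(P)` when `σ|_K = 1` and `F(σP) = −σF(P)` when `σ|_K ≠ 1` (*AEC* X.5 Cor. 5.4 + §1).
[cite: SilvermanAEC2009, X.5 Cor. 5.4 and X.2 Prop. 2.4] -/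
theorem exists_twistIso_sign_absGaloisQuot (W : WeierstrassCurve ℚ) (hK : IsImaginaryQuadratic K) :
    ∃ F : (W.quadraticTwist (discr K : ℚ)).geomPoints ≃+ W.geomPoints,
      ∀ σ : absoluteGaloisGroup ℚ,
        (haveI : Algebra.IsQuadraticExtension ℚ K := ⟨hK.1⟩; absGaloisQuot ℚ K σ = 1) ∧ (∀ P, F (σ • P) = σ • F P) ∨
        (haveI : Algebra.IsQuadraticExtension ℚ K := ⟨hK.1⟩; absGaloisQuot ℚ K σ ≠ 1) ∧ (∀ P, F (σ • P) = -(σ • F P)) := by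
  haveI : Algebra.IsQuadraticExtension ℚ K := ⟨hK.1⟩
  have hd0 : (discr K : ℚ) ≠ 0 := by exact_mod_cast (IsImaginaryQuadratic.discr_neg hK).ne
  obtain ⟨F, hpos, hneg⟩ := W.exists_addEquiv_geomPoints_quadraticTwist_sign hd0
  refine ⟨F, fun σ ↦ ?_⟩
  by_cases hσ : absGaloisQuot ℚ K σ = 1
  · exact Or.inl ⟨hσ, hpos σ (smul_geomSqrt_discr_eq_of_absGaloisQuot_eq_one hK.1 hσ)⟩
  · exact Or.inr ⟨hσ, hneg σ (smul_geomSqrt_discr_eq_neg_of_absGaloisQuot_ne_one hK hσ)⟩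

end Sign

/-! ## §2 Anti-invariant points of `E(K)` are twin points -/

section Anti

variable (W : WeierstrassCurve ℚ) {K : Type} [Field K] [NumberField K]

/-- **Galois action on `e_*Y` for an ANTI-invariant `Y ∈ E(K)`** (`τY = −Y`, `τ` the non-trivial automorphism of the quadratic `K`):
`σ • e_*Y = e_*Y` when `σ|_K = 1` and `σ • e_*Y = −e_*Y` when `σ|_K ≠ 1` (`= τ`). [cite: SilvermanAEC2009, VIII.§1]
[cite: GrossLMS1991, §5 Prop. 5.3] -/
theorem smul_map_absEmbedding_of_anti (h2 : Module.finrank ℚ K = 2) {τ : K ≃ₐ[ℚ] K} (hτ : τ ≠ 1)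
    {Y : (W.baseChange K).toAffine.Point} (hanti : τ • Y = -Y) (σ : absoluteGaloisGroup ℚ) :
    haveI : Algebra.IsQuadraticExtension ℚ K := ⟨h2⟩
    (absGaloisQuot ℚ K σ = 1 →
      σ • (show W.geomPoints from Affine.Point.map (W' := W) (absEmbedding ℚ K) Y) =
        Affine.Point.map (W' := W) (absEmbedding ℚ K) Y) ∧
    (absGaloisQuot ℚ K σ ≠ 1 →
      σ • (show W.geomPoints from Affine.Point.map (W' := W) (absEmbedding ℚ K) Y) =
        -Affine.Point.map (W' := W) (absEmbedding ℚ K) Y) := by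
  haveI : Algebra.IsQuadraticExtension ℚ K := ⟨h2⟩
  haveI : IsGalois ℚ K := inferInstance
  have hγ : ∀ x : K, σ • absEmbedding ℚ K x = absEmbedding ℚ K (absGaloisQuot ℚ K σ x) :=
    fun x ↦ (absEmbedding_absGaloisQuot_apply ℚ K σ x).symm
  have key := smul_eq_map_absEmbedding_smul W hγ Y _ rfl
  refine ⟨fun h1 ↦ ?_, fun h1 ↦ ?_⟩
  · rw [key, h1, one_smul]
  · rcases Literature.NumberTheory.NumberFields.algEquiv_eq_one_or_eq_of_finrank_eq_two h2 hτ (absGaloisQuot ℚ K σ)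
      with h | h
    · exact absurd h h1
    · rw [key, h, hanti, map_neg]

/-- **AN ANTI-INVARIANT POINT OF `E(K)` IS A TWIN POINT**: for `F` a signed untwisting read on `K` (§1) and `Y ∈ E(K)` with
`τY = −Y`, the point `F⁻¹(e_*Y)` is `Γ_ℚ`-fixed, hence `= z̃` for a unique `z ∈ E^{(d_K)}(ℚ)` (Galois descent over `ℚ`):
`F z̃ = e_*Y`. [cite: SilvermanAEC2009, X.5 Cor. 5.4, VIII.§1] -/
theorem exists_twin_point_of_anti (hK : IsImaginaryQuadratic K) {τ : K ≃ₐ[ℚ] K} (hτ : τ ≠ 1)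
    (F : (W.quadraticTwist (discr K : ℚ)).geomPoints ≃+ W.geomPoints)
    (hF : ∀ σ : absoluteGaloisGroup ℚ,
      (haveI : Algebra.IsQuadraticExtension ℚ K := ⟨hK.1⟩; absGaloisQuot ℚ K σ = 1) ∧ (∀ P, F (σ • P) = σ • F P) ∨
      (haveI : Algebra.IsQuadraticExtension ℚ K := ⟨hK.1⟩; absGaloisQuot ℚ K σ ≠ 1) ∧ (∀ P, F (σ • P) = -(σ • F P)))
    {Y : (W.baseChange K).toAffine.Point} (hanti : τ • Y = -Y) :
    ∃ z : (W.quadraticTwist (discr K : ℚ)).toAffine.Point,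
      F (toGeomPoints _ z) = Affine.Point.map (W' := W) (absEmbedding ℚ K) Y := by
  haveI : Algebra.IsQuadraticExtension ℚ K := ⟨hK.1⟩
  haveI : PerfectField ℚ := PerfectField.ofCharZero
  set eY : W.geomPoints := Affine.Point.map (W' := W) (absEmbedding ℚ K) Y with heY
  have hfix : ∀ σ : absoluteGaloisGroup ℚ, σ • F.symm eY = F.symm eY := by
    intro σ
    obtain ⟨hone, hne⟩ := smul_map_absEmbedding_of_anti W hK.1 hτ hanti σ
    apply F.injective
    rcases hF σ with ⟨h1, hpos⟩ | ⟨h1, hneg⟩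
    · rw [hpos, F.apply_symm_apply, hone h1]
    · rw [hneg, F.apply_symm_apply, hne h1]
      exact neg_neg _
  obtain ⟨z, hz⟩ := WeierstrassCurve.exists_toGeomPoints_eq_of_forall_smul_eq (W.quadraticTwist (discr K : ℚ)) hfix
  exact ⟨z, by rw [hz, F.apply_symm_apply]⟩

/-- **The twin point has NON-ZERO Kummer class when `e_*Y` has no `res(Γ_K)`-rational half**: if `κ(z) = 0` then `z = 2z'` with
`z' ∈ E^{(d_K)}(ℚ)` and `H = F z̃'` is a half of `e_*Y` fixed by every `σ` with `σ|_K = 1`.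
[cite: SilvermanAEC2009, VIII §2 (Kummer sequence), X.5 Cor. 5.4] -/
theorem kummer_ne_zero_of_no_rational_half (hK : IsImaginaryQuadratic K)
    (F : (W.quadraticTwist (discr K : ℚ)).geomPoints ≃+ W.geomPoints)
    (hF : ∀ σ : absoluteGaloisGroup ℚ,
      (haveI : Algebra.IsQuadraticExtension ℚ K := ⟨hK.1⟩; absGaloisQuot ℚ K σ = 1) ∧ (∀ P, F (σ • P) = σ • F P) ∨
      (haveI : Algebra.IsQuadraticExtension ℚ K := ⟨hK.1⟩; absGaloisQuot ℚ K σ ≠ 1) ∧ (∀ P, F (σ • P) = -(σ • F P)))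
    {Y : (W.baseChange K).toAffine.Point} {z : (W.quadraticTwist (discr K : ℚ)).toAffine.Point}
    (hz : F (toGeomPoints _ z) = Affine.Point.map (W' := W) (absEmbedding ℚ K) Y)
    (hY2 : ∀ H : W.geomPoints, (2 : ℤ) • H = Affine.Point.map (W' := W) (absEmbedding ℚ K) Y →
      ∃ σ : absoluteGaloisGroup ℚ, (haveI : Algebra.IsQuadraticExtension ℚ K := ⟨hK.1⟩; absGaloisQuot ℚ K σ = 1) ∧ σ • H ≠ H) :
    kummerMapTorsion (W.quadraticTwist (discr K : ℚ)) ((2 : ℕ) : ℤ) (hdiv_two _) z ≠ 0 := by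
  haveI : Algebra.IsQuadraticExtension ℚ K := ⟨hK.1⟩
  intro h0
  -- read `κ(z) = 0` geometrically: `Q − T` is `Γ_ℚ`-fixed for the chosen root `Q` of `z̃` and some `T ∈ E^{(d)}[2]`
  have hQfix := zsmul_zsmulRoot_mem (W.quadraticTwist (discr K : ℚ)) ((2 : ℕ) : ℤ) (hdiv_two _) z
  have h0' : kummerClassTorsion (W.quadraticTwist (discr K : ℚ)) ((2 : ℕ) : ℤ)
      (zsmulRoot (W.quadraticTwist (discr K : ℚ)) ((2 : ℕ) : ℤ) (hdiv_two _) z) hQfix = 0 := h0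
  rw [kummerClassTorsion_eq_zero_iff] at h0'
  obtain ⟨T, hT, hfixQ⟩ := h0'
  have hQ2 : ((2 : ℕ) : ℤ) • zsmulRoot (W.quadraticTwist (discr K : ℚ)) ((2 : ℕ) : ℤ) (hdiv_two _) z = toGeomPoints _ z :=
    zsmul_zsmulRoot (W.quadraticTwist (discr K : ℚ)) ((2 : ℕ) : ℤ) (hdiv_two _) z
  have hT2 : ((2 : ℕ) : ℤ) • T = 0 := (mem_geomTorsion_iff (W.quadraticTwist (discr K : ℚ)) ((2 : ℕ) : ℤ) T).mp hT
  -- `H = F (Q − T)` is a half of `e_*Y` fixed by `res(Γ_K)`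
  obtain ⟨σ, hσ1, hσH⟩ := hY2 (F (zsmulRoot (W.quadraticTwist (discr K : ℚ)) ((2 : ℕ) : ℤ) (hdiv_two _) z - T))
    (by rw [← show ((2 : ℕ) : ℤ) = (2 : ℤ) from Nat.cast_ofNat, ← map_zsmul, zsmul_sub, hQ2, hT2, sub_zero, hz])
  apply hσH
  rcases hF σ with ⟨-, hpos⟩ | ⟨hne, -⟩
  · rw [← hpos]
    exact congrArg F (hfixQ σ)
  · exact absurd hσ1 hne

end Anti

/-! ## §3 Claim B on the curve: an anti-invariant point of `E(K)` with no rational half reduces away from `Õ` -/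

section Curve

variable (W : WeierstrassCurve ℚ) [W.IsElliptic] [W.IsGloballyMinimal]

/-- **CLAIM B ON THE CURVE (the `#Sel₂(E) = 1` cell of the prime Heegner twin).** `W/ℚ` globally minimal elliptic with `Δ_W < 0`, `K`
imaginary quadratic with `d_K = −ℓ` (`ℓ` an odd prime), Heegner for `N_W`, `#Sel₂(W) = 1`, `τ` the non-trivial automorphism of `K`,
`Y ∈ E(K)` with `τY = −Y` such that `e_*Y ∈ E(ℚ̄)` has NO half fixed by every `σ ∈ Γ_ℚ` with `σ|_K = 1` (the geometric form of
`Y ∉ 2E(K)`). THEN **`red_𝔓(e_*Y) ≠ Õ`**, `red_𝔓 = geomReduction` along the tree's place over `ℓ` (`ℓ ∤ Δ_min(W)`: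
`not_dvd_minimalDiscriminantInt_of_discr_eq_neg_prime`). Assembly: §2 makes `e_*Y = F z̃` for a twin point `z ∈ E^{(d_K)}(ℚ)` with
`κ(z) ≠ 0`; the twisted local reading on the cell (`geomReduction_twist_ne_zero_of_kummer_ne_zero_of_selmerTrivial_prime`:
global half p763963 + decomposition-group reading + kernel half p764224) gives `red(F z̃) ≠ Õ`. For the LEAD's R₁: take
`Y = P₀ − s₀`, `P₀ ↦ y_K`, `2s₀ = P₀ + τP₀` (Gross 5.3). [cite: MazurRubin2010, Prop. 3.3, Cor. 3.4 (i)]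
[cite: SilvermanAEC2009, X.5 Cor. 5.4, VIII §1–§2, VII.3.1] [cite: GrossLMS1991, §5 Prop. 5.3] -/
theorem geomReduction_map_absEmbedding_ne_zero_of_anti_of_selmerTrivial_prime
    {K : Type} [Field K] [NumberField K] (hΔneg : W.Δ < 0) (hK : IsImaginaryQuadratic K)
    (hH : SatisfiesHeegnerHypothesis (W.conductorNorm ℤ) K) {ℓ : ℕ} [Fact ℓ.Prime] (hℓ2 : ℓ ≠ 2) (hd : discr K = -(ℓ : ℤ))
    (h1 : Nat.card (W.selmerGroup 2) = 1) {τ : K ≃ₐ[ℚ] K} (hτ : τ ≠ 1)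
    {Y : (W.baseChange K).toAffine.Point} (hanti : τ • Y = -Y)
    (hY2 : ∀ H : W.geomPoints, (2 : ℤ) • H = Affine.Point.map (W' := W) (absEmbedding ℚ K) Y →
      ∃ σ : absoluteGaloisGroup ℚ, (haveI : Algebra.IsQuadraticExtension ℚ K := ⟨hK.1⟩; absGaloisQuot ℚ K σ = 1) ∧ σ • H ≠ H)
    (hΔ : ¬ (ℓ : ℤ) ∣ minimalDiscriminantInt W) :
    geomReduction hΔ (Affine.Point.map (W' := W) (absEmbedding ℚ K) Y : W.geomPoints) ≠ 0 := by
  have hd0 : (discr K : ℚ) ≠ 0 := by exact_mod_cast (IsImaginaryQuadratic.discr_neg hK).ne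
  haveI : (W.quadraticTwist (discr K : ℚ)).IsElliptic := W.isElliptic_quadraticTwist hd0
  obtain ⟨F, hF⟩ := exists_twistIso_sign_absGaloisQuot W hK
  obtain ⟨z, hz⟩ := exists_twin_point_of_anti W hK hτ F hF hanti
  have hκ := kummer_ne_zero_of_no_rational_half W hK F hF hz hY2
  have hF' : ∀ σ : absoluteGaloisGroup ℚ, (∀ P, F (σ • P) = σ • F P) ∨ (∀ P, F (σ • P) = -(σ • F P)) := fun σ ↦
    (hF σ).imp (fun h ↦ h.2) (fun h ↦ h.2)
  have hC : (1 : VariableChange ℚ) • W.quadraticTwist (discr K : ℚ) = W.quadraticTwist (discr K : ℚ) := one_smul _ _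
  rw [← hz]
  exact geomReduction_twist_ne_zero_of_kummer_ne_zero_of_selmerTrivial_prime W hΔneg hK hH hℓ2 hd hC F hF' h1 z hκ hΔ

end Curve

end Summit.BirchSwinnertonDyer.BirchSwinnertonDyer.Theorems.GenusSupplyNarrow.DepthZero

end
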